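import Literature.Computability.AlgebraicComplexity.ValiantKitBlocks
import HarnessLib

/-!
# Factor systems and their permanents

The interface between the combinatorial half (parse-tree / token expansion of a `VP⁰` circuit,
sibling files) and the linear-algebra half (`ValiantKitBlocks.lean`, `PermanentBooleanSum*.lean`)
of the constant-free completeness proof for the permanent behind Bürgisser 2009, Thm. 2.10
(`ConstantFreeCompleteness.Burgisser2009_perProjection`).

* `FKind R V` — the kinds of local factors over Boolean variables `V`: `top t`,
  `mul p₁ p₂ ts`, `add p₁ p₂ ts`, `pass c p ts`, `leaf ℓ ts`, `chain₀ a ts`, `chain a' a ts`,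
  `fin a` (`ts` = incoming tokens, read through their OR `s`); `FKind.slots` (all variables read,
  in order), `FKind.ins`, `FKind.spec` (the value at a Boolean point: `[p₁ = s][p₂ = s]`,
  `[s=0][p₁=p₂=0] + [s=1][p₁+p₂=1]`, `[s=0][p=0] + [s=1] c [p=1]`, `ℓ^{[s=1]}`, `[a = ¬s]`,
  `[a = a' ∧ ¬s]`, `1 + [a]`, `[t]`), `FKind.Care` (at most one incoming token set — the only
  inputs on which the values are ever used);
* `FKind.exists_block` — every kind is a read-once permanent block of the kit: size
  `≤ 6 + #ins`, entries in `P ∋ 0, ±1` (and the parameter), one site per slot with coefficient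
  `±1`, permanent `= spec` on the inputs that matter;
* `BlockPkg`, `exists_assembly` — block-diagonal assembly of realized blocks
  (`Matrix.permanent_fromBlocks_zero₁₂`);
* `FactorSystem R` — variables `V`, factors `kind : Fin m → FKind R V`, and the two occurrences
  `occ v false/true` of every variable (a bijection `V × Bool ≃ slots`, `occSlot_bijective`, the two
  occurrences in DIFFERENT factors); `FactorSystem.Admissible F` (a realisation with the
  specified values on the inputs that matter);
* `FactorSystem.exists_permanent` — **the output of the linear-algebra half**: an `N × N`
  matrix `B`, `N ≤ 6m + 6#V`, entries in `P`, and an admissible `F` with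
  `per B = 2^{#V} · ∑_{b : V → Bool} ∏_f F f b`.

The combinatorial half will supply, for the `VP⁰` circuit of `g_n` (`f_n = ∑_e g_n(X, e)`), a
factor system with `∑_b ∏_f F f b = ∑_e g_n(X, e)` for EVERY admissible `F` (Malod–Portier 2008,
Thm. 2: `VNP = VNP_e` by parse trees of multiplicatively disjoint circuits, in a token form in
which every Boolean variable is read exactly twice).

## References

* G. Malod, N. Portier, *Characterizing Valiant's algebraic complexity classes*, J. Complexity
  24 (2008) 16–38, Thm. 2 and its proof (the local conditions (1)–(4) of a parse tree).
* P. Bürgisser, M. Clausen, M. A. Shokrollahi, *Algebraic Complexity Theory*, Springer 1997,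
  §21.2–21.4.
* P. Bürgisser, *On defining integers and proving arithmetic circuit lower bounds*, Comput.
  Complexity 18 (2009), proof of Thm. 2.10.
-/

namespace Literature.Computability.AlgebraicComplexity

open _root_.Matrix Finset _root_.Literature.LinearAlgebra.Matrix

universe u

/-! ### Factor kinds -/

/-- The kinds of local factors of a factor system over the ring `R` with Boolean variables `V`.
In each kind `ts` is the list of INCOMING token variables (the demand, read through their OR);
the other arguments are outgoing tokens / chain variables / parameters:
`top t = [t]`, `mul p₁ p₂ ts = [p₁ = s][p₂ = s]`, `add p₁ p₂ ts = [s = 0][p₁ = p₂ = 0] + [s = 1][p₁ + p₂ = 1]`,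
`pass c p ts = [s = 0][p = 0] + [s = 1] c [p = 1]`, `leaf ℓ ts = ℓ^{[s = 1]}`,
`chain₀ a ts = [a = ¬ s]`, `chain a' a ts = [a = a' ∧ ¬ s]`, `fin a = 1 + [a]`, where `s = ⋁ ts`. [folklore] -/
inductive FKind (R : Type u) (V : Type) : Type u
  /-- the root demand -/
  | top (t : V)
  /-- a product node: both children inherit the demand -/
  | mul (p₁ p₂ : V) (ts : List V)
  /-- a sum node: exactly one child inherits the demand -/
  | add (p₁ p₂ : V) (ts : List V)
  /-- a coefficient node: the child inherits the demand, weight `c` -/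
  | pass (c : R) (p : V) (ts : List V)
  /-- a leaf with label `ℓ` -/
  | leaf (ℓ : R) (ts : List V)
  /-- start of an AND-chain: `a = ¬ s` -/
  | chain₀ (a : V) (ts : List V)
  /-- link of an AND-chain: `a = a' ∧ ¬ s` -/
  | chain (a' a : V) (ts : List V)
  /-- end of an AND-chain: weight `1 + [a]` -/
  | fin (a : V)

namespace FKind

variable {R : Type u} {V : Type}

/-- The incoming token variables. [folklore] -/
def ins : FKind R V → List V
  | top _ => []
  | mul _ _ ts => ts
  | add _ _ ts => ts
  | pass _ _ ts => ts
  | leaf _ ts => ts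
  | chain₀ _ ts => ts
  | chain _ _ ts => ts
  | fin _ => []

/-- All variables read by the factor, in a fixed order (its *slots*). [folklore] -/
def slots : FKind R V → List V
  | top t => [t]
  | mul p₁ p₂ ts => p₁ :: p₂ :: ts
  | add p₁ p₂ ts => p₁ :: p₂ :: ts
  | pass _ p ts => p :: ts
  | leaf _ ts => ts
  | chain₀ a ts => a :: ts
  | chain a' a ts => a' :: a :: ts
  | fin a => [a]

/-- The number of leading slots (outgoing tokens / chain variables) before the incoming ones. [folklore] -/
def pre : FKind R V → ℕ
  | top _ => 1
  | mul _ _ _ => 2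
  | add _ _ _ => 2
  | pass _ _ _ => 1
  | leaf _ _ => 0
  | chain₀ _ _ => 1
  | chain _ _ _ => 2
  | fin _ => 1

/-- `#slots = pre + #ins`. [folklore] -/
theorem slots_length (k : FKind R V) : k.slots.length = k.pre + k.ins.length := by
  cases k <;> simp [slots, pre, ins] <;> omega

/-- The slots after the leading ones are the incoming tokens. [folklore] -/
theorem get_slots_pre_add (k : FKind R V) (i : ℕ) (h : k.pre + i < k.slots.length) :
    k.slots.get ⟨k.pre + i, h⟩ = k.ins.get ⟨i, by have := k.slots_length; omega⟩ := by
  cases k <;> simp only [slots, pre, ins, List.get_eq_getElem] <;>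
    first
    | rfl
    | (simp only [show 2 + i = i + 1 + 1 by omega, List.getElem_cons_succ])
    | (simp only [show 1 + i = i + 1 by omega, List.getElem_cons_succ])
    | (simp only [Nat.zero_add])

/-- The parameters (coefficient / label) of the factor lie in `P`. [folklore] -/
def ParamIn (P : R → Prop) : FKind R V → Prop
  | pass c _ _ => P c
  | leaf ℓ _ => P ℓ
  | _ => True

/-- **The inputs that matter**: at most one incoming token is set. [folklore] -/
def Care (k : FKind R V) (b : V → Bool) : Prop :=
  k.ins.countP b ≤ 1

variable [CommRing R]

/-- **The value of a factor** at a Boolean point (`s` = some incoming token is set). [folklore] -/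
def spec (k : FKind R V) (b : V → Bool) : R :=
  match k with
  | top t => if b t then 1 else 0
  | mul p₁ p₂ ts => if b p₁ = ts.any b ∧ b p₂ = ts.any b then 1 else 0
  | add p₁ p₂ ts =>
      if ts.any b then (if b p₁ ≠ b p₂ then 1 else 0)
      else (if b p₁ = false ∧ b p₂ = false then 1 else 0)
  | pass c p ts => if ts.any b then (if b p then c else 0) else (if b p then 0 else 1)
  | leaf ℓ ts => if ts.any b then ℓ else 1
  | chain₀ a ts => if b a = !(ts.any b) then 1 else 0
  | chain a' a ts => if b a = (b a' && !(ts.any b)) then 1 else 0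
  | fin a => if b a then 2 else 1

/-- Counting the set tokens of a list: `∑_i [b (ts_i)] = countP b ts`. [folklore] -/
theorem sum_ite_get (ts : List V) (b : V → Bool) :
    (∑ i : Fin ts.length, (if b (ts.get i) then (1 : R) else 0)) = ts.countP b := by
  induction ts with
  | nil => simp
  | cons v ts ih =>
    show (∑ i : Fin (ts.length + 1), if b ((v :: ts).get i) = true then (1 : R) else 0) = _
    rw [Fin.sum_univ_succ]
    have h0 : (v :: ts).get 0 = v := rfl
    have hs : ∀ i : Fin ts.length, (v :: ts).get i.succ = ts.get i := fun i => rfl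
    simp only [h0, hs, ih, List.countP_cons]
    cases b v <;> simp [add_comm]

/-- On the inputs that matter the sum of the incoming tokens is their OR. [folklore] -/
theorem sum_ite_get_of_care (ts : List V) (b : V → Bool) (h : ts.countP b ≤ 1) :
    (∑ i : Fin ts.length, (if b (ts.get i) then (1 : R) else 0)) = if ts.any b then 1 else 0 := by
  rw [sum_ite_get]
  by_cases hany : ts.any b
  · have hpos : 0 < ts.countP b := List.countP_pos_iff.2 (List.any_eq_true.1 hany)
    have : ts.countP b = 1 := by omega
    simp [this, hany]
  · have h0 : ts.countP b = 0 := by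
      rw [List.countP_eq_zero]
      intro v hv hb
      exact hany (List.any_eq_true.2 ⟨v, hv, hb⟩)
    simp [h0, hany]

/-- Boolean indicators in the ring. [folklore] -/
theorem ite_neg_one_eq (c : Bool) : (if c then (-1 : R) else 0) = -1 * (if c then 1 else 0) := by
  cases c <;> simp

/-- **Every factor kind is a read-once permanent block** (the kit of `ValiantKitBlocks.lean`):
a matrix `M` with entries in `P` (`∋ 0, ±1` and the parameters), of size `≤ 6 + #ins`, one
site per slot with coefficient `±1`, such that on every input that matters the permanent of
`M + ∑_j [b (slot_j)] coef_j E_{site_j}` is the value of the factor. [folklore] -/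
theorem exists_block (k : FKind R V) (P : R → Prop) (h0 : P 0) (h1 : P 1) (hn1 : P (-1))
    (hk : k.ParamIn P) :
    ∃ (κ : Type) (_ : Fintype κ) (_ : DecidableEq κ) (M : Matrix κ κ R)
      (site : Fin k.slots.length → κ × κ) (coef : Fin k.slots.length → R),
      Fintype.card κ ≤ 6 + k.ins.length ∧ (∀ x y, P (M x y)) ∧ (∀ j, coef j = 1 ∨ coef j = -1) ∧
      ∀ b : V → Bool, k.Care b →
        (M + ∑ j, single (site j).1 (site j).2 (if b (k.slots.get j) then coef j else 0)).permanent =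
          k.spec b := by
  cases k with
  | top t =>
    obtain ⟨κ, _, _, M, st, hcard, hM, hper⟩ := Kit.exists_topBlock (R := R) P h0
    refine ⟨κ, inferInstance, inferInstance, M, fun _ => st, fun _ => 1, by simp [ins, hcard], hM,
      fun _ => Or.inl rfl, fun b _ => ?_⟩
    show (M + ∑ j : Fin 1, single st.1 st.2 (if b ([t].get j) then 1 else 0)).permanent = _
    rw [Fin.sum_univ_one]
    show (M + single st.1 st.2 (if b t then 1 else 0)).permanent = _
    rw [hper]
    simp [spec]
  | fin a =>
    obtain ⟨κ, _, _, M, st, hcard, hM, hper⟩ := Kit.exists_finBlock (R := R) P h1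
    refine ⟨κ, inferInstance, inferInstance, M, fun _ => st, fun _ => 1, by simp [ins, hcard], hM,
      fun _ => Or.inl rfl, fun b _ => ?_⟩
    show (M + ∑ j : Fin 1, single st.1 st.2 (if b ([a].get j) then 1 else 0)).permanent = _
    rw [Fin.sum_univ_one]
    show (M + single st.1 st.2 (if b a then 1 else 0)).permanent = _
    rw [hper]
    cases h : b a <;> simp [spec, h]
    norm_num
  | mul p₁ p₂ ts =>
    obtain ⟨κ, _, _, M, sp₁, sp₂, st, hcard, hM, hper⟩ := Kit.exists_mulBlockN (R := R) P h0 h1 hn1 ts.length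
    refine ⟨κ, inferInstance, inferInstance, M, Fin.cons sp₁ (Fin.cons sp₂ st), fun _ => 1,
      by simp [ins, hcard], hM, fun _ => Or.inl rfl, fun b hb => ?_⟩
    show (M + ∑ j : Fin (ts.length + 1 + 1), single ((Fin.cons sp₁ (Fin.cons sp₂ st) : Fin _ → κ × κ) j).1
      ((Fin.cons sp₁ (Fin.cons sp₂ st) : Fin _ → κ × κ) j).2
      (if b ((p₁ :: p₂ :: ts).get j) then 1 else 0)).permanent = _
    rw [Fin.sum_univ_succ, Fin.sum_univ_succ]
    have g0 : (p₁ :: p₂ :: ts).get 0 = p₁ := rfl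
    have g1 : (p₁ :: p₂ :: ts).get (Fin.succ 0) = p₂ := rfl
    have g2 : ∀ i : Fin ts.length, (p₁ :: p₂ :: ts).get i.succ.succ = ts.get i := fun i => rfl
    simp only [Fin.cons_zero, Fin.cons_succ, g0, g1, g2, ← add_assoc]
    rw [hper, sum_ite_get_of_care ts b hb]
    simp only [spec]
    cases b p₁ <;> cases b p₂ <;> cases ts.any b <;> simp
  | add p₁ p₂ ts =>
    obtain ⟨κ, _, _, M, sp₁, sp₂, st, hcard, hM, hper⟩ := Kit.exists_addBlockN (R := R) P h0 h1 hn1 ts.length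
    refine ⟨κ, inferInstance, inferInstance, M, Fin.cons sp₁ (Fin.cons sp₂ st), fun _ => 1,
      by simp [ins, hcard], hM, fun _ => Or.inl rfl, fun b hb => ?_⟩
    show (M + ∑ j : Fin (ts.length + 1 + 1), single ((Fin.cons sp₁ (Fin.cons sp₂ st) : Fin _ → κ × κ) j).1
      ((Fin.cons sp₁ (Fin.cons sp₂ st) : Fin _ → κ × κ) j).2
      (if b ((p₁ :: p₂ :: ts).get j) then 1 else 0)).permanent = _
    rw [Fin.sum_univ_succ, Fin.sum_univ_succ]
    have g0 : (p₁ :: p₂ :: ts).get 0 = p₁ := rfl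
    have g1 : (p₁ :: p₂ :: ts).get (Fin.succ 0) = p₂ := rfl
    have g2 : ∀ i : Fin ts.length, (p₁ :: p₂ :: ts).get i.succ.succ = ts.get i := fun i => rfl
    simp only [Fin.cons_zero, Fin.cons_succ, g0, g1, g2, ← add_assoc]
    rw [hper, sum_ite_get_of_care ts b hb]
    simp only [spec]
    cases b p₁ <;> cases b p₂ <;> cases ts.any b <;> simp <;> ring
  | pass c p ts =>
    obtain ⟨κ, _, _, M, sp, st, hcard, hM, hper⟩ := Kit.exists_passBlockN (R := R) P h0 h1 hn1 c hk ts.length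
    refine ⟨κ, inferInstance, inferInstance, M, Fin.cons sp st, fun _ => 1,
      by simp [ins, hcard], hM, fun _ => Or.inl rfl, fun b hb => ?_⟩
    show (M + ∑ j : Fin (ts.length + 1), single ((Fin.cons sp st : Fin _ → κ × κ) j).1
      ((Fin.cons sp st : Fin _ → κ × κ) j).2 (if b ((p :: ts).get j) then 1 else 0)).permanent = _
    rw [Fin.sum_univ_succ]
    have g0 : (p :: ts).get 0 = p := rfl
    have g1 : ∀ i : Fin ts.length, (p :: ts).get i.succ = ts.get i := fun i => rfl
    simp only [Fin.cons_zero, Fin.cons_succ, g0, g1, ← add_assoc]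
    rw [hper, sum_ite_get_of_care ts b hb]
    simp only [spec]
    cases b p <;> cases ts.any b <;> simp
  | leaf ℓ ts =>
    obtain ⟨κ, _, _, M, st, hcard, hM, hper⟩ := Kit.exists_leafBlockN (R := R) P h0 h1 hn1 ℓ hk ts.length
    refine ⟨κ, inferInstance, inferInstance, M, st, fun _ => 1,
      by simp [ins, hcard], hM, fun _ => Or.inl rfl, fun b hb => ?_⟩
    show (M + ∑ j : Fin ts.length, single (st j).1 (st j).2 (if b (ts.get j) then 1 else 0)).permanent = _
    rw [hper, sum_ite_get_of_care ts b hb]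
    simp only [spec]
    cases ts.any b <;> simp
  | chain₀ a ts =>
    obtain ⟨κ, _, _, M, sa, st, hcard, hM, hper⟩ := Kit.exists_chain0BlockN (R := R) P h0 h1 hn1 ts.length
    refine ⟨κ, inferInstance, inferInstance, M, Fin.cons sa st, Fin.cons 1 (fun _ => -1),
      by simp [ins, hcard], hM, ?_, fun b hb => ?_⟩
    · intro j
      refine Fin.cases (Or.inl rfl) (fun i => Or.inr rfl) j
    show (M + ∑ j : Fin (ts.length + 1), single ((Fin.cons sa st : Fin _ → κ × κ) j).1
      ((Fin.cons sa st : Fin _ → κ × κ) j).2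
      (if b ((a :: ts).get j) then (Fin.cons 1 (fun _ => -1) : Fin _ → R) j else 0)).permanent = _
    rw [Fin.sum_univ_succ]
    have g0 : (a :: ts).get 0 = a := rfl
    have g1 : ∀ i : Fin ts.length, (a :: ts).get i.succ = ts.get i := fun i => rfl
    simp only [Fin.cons_zero, Fin.cons_succ, g0, g1, ← add_assoc, ite_neg_one_eq]
    rw [hper, sum_ite_get_of_care ts b hb]
    simp only [spec]
    cases b a <;> cases ts.any b <;> simp
    ring
  | chain a' a ts =>
    obtain ⟨κ, _, _, M, sa', sa, st, hcard, hM, hper⟩ := Kit.exists_chainBlockN (R := R) P h0 h1 hn1 ts.length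
    refine ⟨κ, inferInstance, inferInstance, M, Fin.cons sa' (Fin.cons sa st),
      Fin.cons 1 (Fin.cons 1 (fun _ => -1)), by simp [ins, hcard], hM, ?_, fun b hb => ?_⟩
    · intro j
      refine Fin.cases (Or.inl rfl) (fun i => Fin.cases (Or.inl rfl) (fun i => Or.inr rfl) i) j
    show (M + ∑ j : Fin (ts.length + 1 + 1), single ((Fin.cons sa' (Fin.cons sa st) : Fin _ → κ × κ) j).1
      ((Fin.cons sa' (Fin.cons sa st) : Fin _ → κ × κ) j).2
      (if b ((a' :: a :: ts).get j) then (Fin.cons 1 (Fin.cons 1 (fun _ => -1)) : Fin _ → R) j else 0)).permanent = _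
    rw [Fin.sum_univ_succ, Fin.sum_univ_succ]
    have g0 : (a' :: a :: ts).get 0 = a' := rfl
    have g1 : (a' :: a :: ts).get (Fin.succ 0) = a := rfl
    have g2 : ∀ i : Fin ts.length, (a' :: a :: ts).get i.succ.succ = ts.get i := fun i => rfl
    simp only [Fin.cons_zero, Fin.cons_succ, g0, g1, g2, ← add_assoc, ite_neg_one_eq]
    rw [hper, sum_ite_get_of_care ts b hb]
    simp only [spec]
    cases b a <;> cases b a' <;> cases ts.any b <;> simp
    ring

end FKind

/-! ### Assembling blocks into one block-diagonal matrix -/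

/-- A realized block: `n` slots, an index type, the constant matrix, and one site with its
coefficient per slot. [folklore] -/
structure BlockPkg (R : Type u) where
  /-- number of slots -/
  n : ℕ
  /-- index type of the block -/
  κ : Type
  [instF : Fintype κ]
  [instD : DecidableEq κ]
  /-- the constant part -/
  M : Matrix κ κ R
  /-- the site of each slot -/
  site : Fin n → κ × κ
  /-- the coefficient of each slot -/
  coef : Fin n → R

attribute [instance] BlockPkg.instF BlockPkg.instD

variable {R : Type u} [CommRing R]

/-- The block with its slots filled by the values `x`. [folklore] -/
def BlockPkg.eval (B : BlockPkg R) (x : Fin B.n → R) : Matrix B.κ B.κ R :=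
  B.M + ∑ j, single (B.site j).1 (B.site j).2 (x j * B.coef j)

/-- A single-entry matrix in the first diagonal block. [folklore] -/
theorem single_inl_inl {m n : Type} [DecidableEq m] [DecidableEq n] (a b : m) (c : R) :
    (single (Sum.inl a) (Sum.inl b) c : Matrix (m ⊕ n) (m ⊕ n) R) =
      fromBlocks (single a b c) 0 0 0 := by
  ext x y
  rcases x with x | x <;> rcases y with y | y <;> simp [single_apply]

/-- A single-entry matrix in the second diagonal block. [folklore] -/
theorem single_inr_inr {m n : Type} [DecidableEq m] [DecidableEq n] (a b : n) (c : R) :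
    (single (Sum.inr a) (Sum.inr b) c : Matrix (m ⊕ n) (m ⊕ n) R) =
      fromBlocks 0 0 0 (single a b c) := by
  ext x y
  rcases x with x | x <;> rcases y with y | y <;> simp [single_apply]

/-- Sums of first-block matrices. [folklore] -/
theorem sum_fromBlocks₁₁ {m n γ : Type} (s : Finset γ) (A : γ → Matrix m m R) :
    ∑ j ∈ s, fromBlocks (A j) 0 0 (0 : Matrix n n R) = fromBlocks (∑ j ∈ s, A j) 0 0 0 := by
  classical
  induction s using Finset.induction_on with
  | empty => ext x y; rcases x with x | x <;> rcases y with y | y <;> simp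
  | insert a s ha ih => rw [Finset.sum_insert ha, Finset.sum_insert ha, ih, fromBlocks_add]; simp

/-- Sums of second-block matrices. [folklore] -/
theorem sum_fromBlocks₂₂ {m n γ : Type} (s : Finset γ) (A : γ → Matrix n n R) :
    ∑ j ∈ s, fromBlocks (0 : Matrix m m R) 0 0 (A j) = fromBlocks 0 0 0 (∑ j ∈ s, A j) := by
  classical
  induction s using Finset.induction_on with
  | empty => ext x y; rcases x with x | x <;> rcases y with y | y <;> simp
  | insert a s ha ih => rw [Finset.sum_insert ha, Finset.sum_insert ha, ih, fromBlocks_add]; simp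

/-- **Block-diagonal assembly.** For a family of realized blocks there are an index type `ι`
(`#ι = ∑ #κ_f`), a constant matrix `D` (entries: `0` or entries of the blocks) and embeddings
of the blocks with pairwise disjoint images, such that for every filling `x` of the slots the
permanent of `D + (sites)` is the product of the permanents of the filled blocks. [folklore] -/
theorem exists_assembly : ∀ (m : ℕ) (pkg : Fin m → BlockPkg R),
    ∃ (ι : Type) (_ : Fintype ι) (_ : DecidableEq ι) (D : Matrix ι ι R)
      (emb : (f : Fin m) → (pkg f).κ ↪ ι),
      Fintype.card ι = ∑ f, Fintype.card (pkg f).κ ∧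
      (∀ a b, D a b = 0 ∨ ∃ f x y, D a b = (pkg f).M x y) ∧
      (∀ f f' x y, emb f x = emb f' y → f = f') ∧
      ∀ x : (f : Fin m) → Fin (pkg f).n → R,
        (D + ∑ f, ∑ j, single (emb f ((pkg f).site j).1) (emb f ((pkg f).site j).2)
          (x f j * (pkg f).coef j)).permanent = ∏ f, ((pkg f).eval (x f)).permanent
  | 0, pkg => ⟨Fin 0, inferInstance, inferInstance, 0, fun f => Fin.elim0 f, by simp,
      fun a => Fin.elim0 a, fun f => Fin.elim0 f, fun x => by simp [Matrix.permanent_isEmpty]⟩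
  | m + 1, pkg => by
    obtain ⟨ι, _, _, D, emb, hcard, hD, hemb, hper⟩ := exists_assembly m (fun f => pkg f.succ)
    refine ⟨(pkg 0).κ ⊕ ι, inferInstance, inferInstance, fromBlocks (pkg 0).M 0 0 D,
      Fin.cons ⟨Sum.inl, Sum.inl_injective⟩ (fun f => (emb f).trans ⟨Sum.inr, Sum.inr_injective⟩),
      ?_, ?_, ?_, ?_⟩
    · rw [Fintype.card_sum, hcard, Fin.sum_univ_succ]
    · rintro (a | a) (b | b)
      · exact Or.inr ⟨0, a, b, rfl⟩
      · exact Or.inl rfl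
      · exact Or.inl rfl
      · rcases hD a b with h | ⟨f, x, y, h⟩
        · exact Or.inl h
        · exact Or.inr ⟨f.succ, x, y, h⟩
    · intro f f' x y h
      induction f using Fin.cases with
      | zero =>
        induction f' using Fin.cases with
        | zero => rfl
        | succ f' => simp at h
      | succ f =>
        induction f' using Fin.cases with
        | zero => simp at h
        | succ f' =>
          simp only [Fin.cons_succ, Function.Embedding.trans_apply, Function.Embedding.coeFn_mk,
            Sum.inr.injEq] at h
          rw [hemb f f' x y h]
    · intro x
      rw [Fin.sum_univ_succ, Fin.prod_univ_succ]
      simp only [Fin.cons_zero, Fin.cons_succ, Function.Embedding.trans_apply,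
        Function.Embedding.coeFn_mk, single_inl_inl, single_inr_inr, sum_fromBlocks₁₁,
        sum_fromBlocks₂₂]
      rw [← hper (fun f => x f.succ), fromBlocks_add, fromBlocks_add]
      simp only [add_zero, zero_add]
      rw [Matrix.permanent_fromBlocks_zero₁₂]
      rfl

/-! ### Factor systems -/

/-- **A factor system**: Boolean variables `V`, `m` factors of kinds `kind f`, and for every
variable its two occurrences `occ v false`, `occ v true` = (factor, slot index), which lie in two
DIFFERENT factors and together exhaust all slots of all factors. Its value is
`∑_{b : V → Bool} ∏_f spec (kind f) b` (for any admissible realisation of the factors). [folklore] -/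
structure FactorSystem (R : Type u) [CommRing R] where
  /-- the Boolean variables -/
  V : Type
  [instF : Fintype V]
  [instD : DecidableEq V]
  /-- the number of factors -/
  m : ℕ
  /-- the kinds of the factors -/
  kind : Fin m → FKind R V
  /-- the two occurrences of a variable: factor and slot index -/
  occ : V → Bool → Fin m × ℕ
  /-- the slot index is in range -/
  occ_lt : ∀ v i, (occ v i).2 < (kind (occ v i).1).slots.length
  /-- the slot holds the variable -/
  occ_var : ∀ v i, (kind (occ v i).1).slots.get ⟨(occ v i).2, occ_lt v i⟩ = v
  /-- every slot is an occurrence of its variable -/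
  occ_surj : ∀ (f : Fin m) (j : Fin (kind f).slots.length),
    occ ((kind f).slots.get j) false = (f, j.val) ∨ occ ((kind f).slots.get j) true = (f, j.val)
  /-- the two occurrences lie in different factors -/
  occ_ne : ∀ v, (occ v false).1 ≠ (occ v true).1

attribute [instance] FactorSystem.instF FactorSystem.instD

/-! ### Two reindexing lemmas -/

section Reindex

variable {ι : Type} [DecidableEq ι] {W : Type} [Fintype W]

/-- The Boolean points of the list of site pairs `sp ∘ e⁻¹` enumerated along `e : W ≃ Fin n`. [folklore] -/
theorem boolPoint_ofFn (D : Matrix ι ι R) (sp : W → SitePair ι R) {n : ℕ} (e : W ≃ Fin n)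
    (b' : Fin (List.ofFn fun k => sp (e.symm k)).length → Bool) :
    boolPoint D (List.ofFn fun k => sp (e.symm k)) b' =
      D + ∑ w, if b' (Fin.cast (List.length_ofFn).symm (e w)) then (sp w).toMatrix else 0 := by
  simp only [boolPoint]
  congr 1
  refine Fintype.sum_bijective (fun k => e.symm (Fin.cast List.length_ofFn k))
    ((Fin.castOrderIso List.length_ofFn).toEquiv.trans e.symm).bijective _ _ (fun k => ?_)
  have hk : Fin.cast (List.length_ofFn).symm (Fin.cast List.length_ofFn k) = k := Fin.ext rfl
  simp only [List.get_ofFn, Equiv.apply_symm_apply, hk]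

/-- A selection of site-pair matrices as a sum over the single sites. [folklore] -/
theorem sum_ite_toMatrix (c : W → Bool) (u₁ v₁ u₂ v₂ : W → ι) (ε₁ ε₂ : W → R)
    (hu : ∀ w, u₁ w ≠ u₂ w) (hv : ∀ w, v₁ w ≠ v₂ w) :
    (∑ w, if c w then (SitePair.toMatrix ⟨u₁ w, v₁ w, u₂ w, v₂ w, ε₁ w, ε₂ w, hu w, hv w⟩) else 0) =
      ∑ p : W × Bool, single (if p.2 then u₂ p.1 else u₁ p.1) (if p.2 then v₂ p.1 else v₁ p.1)
        ((if c p.1 then 1 else 0) * (if p.2 then ε₂ p.1 else ε₁ p.1)) := by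
  rw [Fintype.sum_prod_type]
  refine Finset.sum_congr rfl fun w _ => ?_
  rw [Fintype.sum_bool]
  by_cases hc : c w
  · simp only [hc, if_true, one_mul, SitePair.toMatrix]
    exact add_comm _ _
  · simp [hc]

end Reindex

namespace FactorSystem

variable (S : FactorSystem R)

/-- A realisation `F f b` of the factors is admissible if it only reads the slots of each factor
and has the specified values on the inputs that matter. [folklore] -/
def Admissible (F : Fin S.m → (S.V → Bool) → R) : Prop :=
  (∀ f b b', (∀ v ∈ (S.kind f).slots, b v = b' v) → F f b = F f b') ∧
    ∀ f b, (S.kind f).Care b → F f b = (S.kind f).spec b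

/-- The slot type. [folklore] -/
abbrev Slot : Type := Σ f : Fin S.m, Fin (S.kind f).slots.length

/-- Occurrences as slots. [folklore] -/
def occSlot (p : S.V × Bool) : S.Slot :=
  ⟨(S.occ p.1 p.2).1, ⟨(S.occ p.1 p.2).2, S.occ_lt p.1 p.2⟩⟩

/-- The variable of an occurrence slot. [folklore] -/
theorem get_occSlot (p : S.V × Bool) : (S.kind (S.occSlot p).1).slots.get (S.occSlot p).2 = p.1 :=
  S.occ_var p.1 p.2

/-- **Occurrences are a bijection** `V × Bool ≃ slots`. [folklore] -/
theorem occSlot_bijective : Function.Bijective S.occSlot := by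
  constructor
  · rintro ⟨v, i⟩ ⟨v', i'⟩ h
    have hv : v = v' := by
      have h1 := S.get_occSlot (v, i)
      rw [h] at h1
      exact h1.symm.trans (S.get_occSlot (v', i'))
    subst hv
    have hf : (S.occ v i).1 = (S.occ v i').1 := congrArg Sigma.fst h
    cases i <;> cases i'
    · rfl
    · exact absurd hf (S.occ_ne v)
    · exact absurd hf.symm (S.occ_ne v)
    · rfl
  · rintro ⟨f, j⟩
    have key : ∀ (q : Fin S.m × ℕ) (hq : q.2 < (S.kind q.1).slots.length), q = (f, j.val) →
        (⟨q.1, ⟨q.2, hq⟩⟩ : S.Slot) = ⟨f, j⟩ := by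
      rintro q hq rfl
      rfl
    rcases S.occ_surj f j with h | h
    · exact ⟨((S.kind f).slots.get j, false), key _ (S.occ_lt _ _) h⟩
    · exact ⟨((S.kind f).slots.get j, true), key _ (S.occ_lt _ _) h⟩

/-- Twice the number of variables is the number of slots. [folklore] -/
theorem two_mul_card_eq : 2 * Fintype.card S.V = ∑ f, (S.kind f).slots.length := by
  have h := Fintype.card_of_bijective S.occSlot_bijective
  rw [Fintype.card_prod, Fintype.card_bool, Fintype.card_sigma] at h
  simp only [Fintype.card_fin] at h
  omega

omit [CommRing R] in
/-- The incoming tokens are among the slots. [folklore] -/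
theorem _root_.Literature.Computability.AlgebraicComplexity.FKind.ins_length_le {V : Type}
    (k : FKind R V) : k.ins.length ≤ k.slots.length := by
  cases k <;> simp [FKind.ins, FKind.slots] <;> omega

/-- **Factor systems are scaled permanents.** For a factor system with parameters in `P`
(`∋ 0, ±1`) there is an `N × N` matrix `B`, `N ≤ 6 m + 6 #V`, with entries in `P`, and an
admissible realisation `F` of the factors, with `per B = 2^{#V} ∑_b ∏_f F f b`: the factors are
the kit blocks (`FKind.exists_block`), assembled block-diagonally (`exists_assembly`); each
Boolean variable then has exactly two sites, in different blocks, and the Boolean sum over all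
of them is absorbed by the gadgets (`exists_permanent_eq_two_pow_mul_boolSum`). [folklore] -/
theorem exists_permanent (P : R → Prop) (h0 : P 0) (h1 : P 1) (hn1 : P (-1))
    (hP : ∀ f, (S.kind f).ParamIn P) :
    ∃ (N : ℕ) (B : Matrix (Fin N) (Fin N) R),
      N ≤ 6 * S.m + 6 * Fintype.card S.V ∧ (∀ a b, P (B a b)) ∧
      ∃ F : Fin S.m → (S.V → Bool) → R, S.Admissible F ∧
        B.permanent = 2 ^ Fintype.card S.V * ∑ b : S.V → Bool, ∏ f, F f b := by
  -- the blocks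
  choose κ hF hD M site coef hcard hM hcoef hval using
    fun f => (S.kind f).exists_block P h0 h1 hn1 (hP f)
  let pkg : Fin S.m → BlockPkg R := fun f =>
    { n := (S.kind f).slots.length, κ := κ f, instF := hF f, instD := hD f, M := M f,
      site := site f, coef := coef f }
  -- the block-diagonal assembly
  obtain ⟨ι, _, _, D, emb, hcardι, hDent, hemb, hperD⟩ := exists_assembly S.m pkg
  -- the two sites of each variable
  let u : S.V × Bool → ι := fun p => emb (S.occSlot p).1 (site _ (S.occSlot p).2).1
  let w : S.V × Bool → ι := fun p => emb (S.occSlot p).1 (site _ (S.occSlot p).2).2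
  let ε : S.V × Bool → R := fun p => coef _ (S.occSlot p).2
  have hu : ∀ v, u (v, false) ≠ u (v, true) := fun v h => S.occ_ne v (hemb _ _ _ _ h)
  have hw : ∀ v, w (v, false) ≠ w (v, true) := fun v h => S.occ_ne v (hemb _ _ _ _ h)
  let sp : S.V → SitePair ι R := fun v =>
    ⟨u (v, false), w (v, false), u (v, true), w (v, true), ε (v, false), ε (v, true), hu v, hw v⟩
  let eV := Fintype.equivFin S.V
  let l : List (SitePair ι R) := List.ofFn fun k : Fin (Fintype.card S.V) => sp (eV.symm k)
  have hl : l.length = Fintype.card S.V := List.length_ofFn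
  -- coefficients and entries are in `P`
  have hPc : ∀ f j, P (coef f j) := fun f j => by
    rcases hcoef f j with h | h <;> rw [h]
    exacts [h1, hn1]
  have hlP : ∀ s ∈ l, P s.ε₁ ∧ P s.ε₂ := by
    intro s hs
    rw [List.mem_ofFn] at hs
    obtain ⟨k, rfl⟩ := hs
    exact ⟨hPc _ _, hPc _ _⟩
  have hDP : ∀ a b, P (D a b) := fun a b => by
    rcases hDent a b with h | ⟨f, x, y, h⟩ <;> rw [h]
    exacts [h0, hM f x y]
  -- the Boolean points of `(D, l)` are the block-diagonal matrices of the filled blocks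
  have hbp : ∀ b' : Fin l.length → Bool,
      boolPoint D l b' = D + ∑ f, ∑ j, single (emb f ((pkg f).site j).1) (emb f ((pkg f).site j).2)
        ((if b' (Fin.cast hl.symm (eV ((S.kind f).slots.get j))) then 1 else 0) * (pkg f).coef j) := by
    intro b'
    rw [boolPoint_ofFn D sp eV b', sum_ite_toMatrix]
    congr 1
    rw [Fintype.sum_bijective S.occSlot S.occSlot_bijective _
      (fun q : S.Slot => single (emb q.1 ((pkg q.1).site q.2).1) (emb q.1 ((pkg q.1).site q.2).2)
        ((if b' (Fin.cast hl.symm (eV ((S.kind q.1).slots.get q.2))) then 1 else 0) *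
          (pkg q.1).coef q.2))
      (fun p => ?_), Fintype.sum_sigma]
    rw [S.get_occSlot p]
    rcases p with ⟨v, _ | _⟩ <;> rfl
  -- absorb the Boolean sum
  obtain ⟨N, B, hN, hB, hperB⟩ := exists_permanent_eq_two_pow_mul_boolSum P h0 h1 hn1 l hlP D hDP
  refine ⟨N, B, ?_, hB,
    fun f b => ((pkg f).eval fun j => if b ((S.kind f).slots.get j) then 1 else 0).permanent,
    ⟨fun f b b' hbb' => ?_, fun f b hb => ?_⟩, ?_⟩
  · -- size
    have hsum : ∑ f, Fintype.card (pkg f).κ ≤ 6 * S.m + 2 * Fintype.card S.V := by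
      calc ∑ f, Fintype.card (pkg f).κ ≤ ∑ f : Fin S.m, (6 + (S.kind f).slots.length) :=
            Finset.sum_le_sum fun f _ => (hcard f).trans
              (Nat.add_le_add_left (S.kind f).ins_length_le 6)
        _ = 6 * S.m + 2 * Fintype.card S.V := by
            rw [Finset.sum_add_distrib, S.two_mul_card_eq]
            simp [mul_comm]
    rw [hN, hcardι, hl]
    omega
  · -- locality
    simp only [BlockPkg.eval]
    congr 2
    refine Finset.sum_congr rfl fun j _ => ?_
    rw [hbb' _ (List.get_mem _ _)]
  · -- admissibility
    show (M f + ∑ j, single (site f j).1 (site f j).2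
      ((if b ((S.kind f).slots.get j) then 1 else 0) * coef f j)).permanent = _
    simp only [boole_mul]
    exact hval f b hb
  · rw [hperB]
    congr 1
    · rw [hl]
    refine Fintype.sum_bijective (fun b' => fun v => b' (Fin.cast hl.symm (eV v)))
      (((eV.trans (Fin.castOrderIso hl.symm).toEquiv).arrowCongr (Equiv.refl Bool)).symm.bijective)
      _ _ (fun b' => ?_)
    rw [hbp b', hperD]
end FactorSystem

end Literature.Computability.AlgebraicComplexity
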